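/-
COR-CM (cell pub-hodgecm2, stage 2 of the Hodge ladder) — count-neutral KERNEL COMBINATORICS «census ↔ tree dictionary, part 5:
the group dictionary» (seat prover-pub-hodgecm2-b23-g33-0, binder prover b23, gen 33; claim INT2-INTRINSIC, HOME/lit/LIT-STATUS.md
2026-08-21T18:02Z; sequel of `CorCM/FaceCensusCells.lean` §3).  Pure group theory / Galois bookkeeping; theorems only; no geometry, no
`Universe`, no definition, no named fact, nothing asserted.  Seat b30's census engine (`Census/FaceSquaresModel.lean`) is used BY NAME;
nothing of theirs is restated or re-filed; `Interfaces.lean` (C1), every E term, B01 and `Transposition/*` are untouched.  HONEST FRAMING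
(COORDINATOR RULING — HODGE FRAMING CORRECTION, 2026-08-21T11:55:35Z): `HC_CM` is NOT proved, here or anywhere in the tree; this file
proves no face period and no generation statement for any particular field.
T5 (coordinator ruling 15:33:56Z (3), lead staging l.4095): n/a-class — NO named-fact / conjecture-def / summit-side supply binder in any
theorem; the ordinary hypotheses of §2–§3 (a bijection / isomorphism between `Aut(F)` or an abstract group and a finite group carrying an
injective multiplicative `enum : Fin n → G`) are jointly inhabited by transport of structure — no contradiction derivable; checker: self
(prover-pub-hodgecm2-b23-g33-0), 2026-08-21T18:10Z.
-/
import Summits.HodgeConjecture.CorCM.FaceCensusCells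
import Mathlib.GroupTheory.SpecificGroups.Cyclic
import Mathlib.GroupTheory.SpecificGroups.Dihedral
import Mathlib.GroupTheory.SpecificGroups.Quaternion
import HarnessLib

/-!
# The group dictionary: census enumerations from the intrinsic Galois group

The per-type field-closure theorems of the census transport (`Census/OcticFaceTransport*.lean`, `Census/DecicFaceTransport.lean`,
`Census/DuodecicFaceTransportCyclic.lean`, automorphism form `…_aut`) take as HYPOTHESES a bijection `ε : Aut(K) ≃ Fin n` that is
multiplicative for seat b30's Cayley table `Γ` together with `ε c = Γ.conj` for the automorphism `c` inducing complex conjugation at the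
base embedding `σ₀`.  This file derives that datum from what a field-specific seat actually knows about `Gal(K/ℚ)`:

* §1 the complex-conjugation automorphism at `σ₀` of a Galois number field: it exists (`exists_conjAut`), is an involution
  (`conjAut_mul_self`), is `≠ 1` when `F` is totally complex (`conjAut_ne_one`, `orderOf_conjAut`), and for a CM field it IS Mathlib's
  `IsCMField.complexConj` on elements (`conjAut_apply`), hence central (`conjAut_comm`) and independent of `σ₀` (`comp_conjAut`);
* §2 `exists_enum_of_groupEnum`: ANY bijection `φ` from a group `A` onto a finite type `G` that is multiplicative for a binary operation
  `op`, composed with b30's certified dictionary `enum : Fin n → G` (`table_spec`: `enum (Γ.mul i j) = op (enum i) (enum j)`, `enum`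
  injective), is an enumeration `ε : A ≃ Fin n` multiplicative for `Γ` with `enum ∘ ε = φ`; involutions go to involutions
  (`enum_autEnum_involution_add/_mul`);
* §3 `exists_enum_of_generator`: for a CYCLIC group with generator `g` and `Nat.card A = n` the bijection is Mathlib's
  `zmodMulEquivOfGenerator`, and `ε (g ^ k)` reads `k (mod n)`;
* §4 the finite-group facts that pin down the image of complex conjugation, all by `decide`: the unique involution of `ZMod 8`,
  `ZMod 10`, `ZMod 12` (`4`, `5`, `6`), of `QuaternionGroup 2` (`a 2`), the unique central involution of `DihedralGroup 4` (`r 2`), the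
  involutions of `ZMod 4 × ZMod 2` (the square one `(2,0)` and the two non-squares, exchanged by an automorphism) and of
  `ZMod 2 × ZMod 2 × ZMod 2` (any non-zero vector is carried to `(1,0,0)` by an automorphism).

References: [cite: Shimura1998, §8.1 (p. 62) and §6.2 Theorem 3]; [cite: Milne1999LefschetzClasses, Thm. 3.2]; Mathlib
`IsCMField.complexConj`, `zmodMulEquivOfGenerator`, `DihedralGroup`, `QuaternionGroup`.
-/

noncomputable section

open NumberField NumberField.ComplexEmbedding

namespace Summit.HodgeConjecture.CorCM.FaceCensus

open Summit.HodgeConjecture.CorCM.Census.FaceSquaresModel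

/-! ## §1 The complex-conjugation automorphism at a base embedding -/

section ConjAut

variable {F : Type} [Field F] [NumberField F]

/-- `σ₀ ∘ (g h) = (σ₀ ∘ g) ∘ h` for automorphisms `g, h` (Mathlib's `AlgEquiv` group: `(g * h) x = g (h x)`). [folklore] -/
theorem comp_coe_mul (σ₀ : F →+* ℂ) (g h : F ≃ₐ[ℚ] F) :
    σ₀.comp ((g * h : F ≃ₐ[ℚ] F) : F →+* F) = (σ₀.comp (g : F →+* F)).comp (h : F →+* F) := by
  ext x; simp [AlgEquiv.mul_apply]

/-- `σ₀ ∘ 1 = σ₀`. [folklore] -/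
theorem comp_coe_one (σ₀ : F →+* ℂ) : σ₀.comp ((1 : F ≃ₐ[ℚ] F) : F →+* F) = σ₀ := by
  ext x; simp

/-- Conjugation commutes with precomposition by an automorphism. [folklore] -/
theorem conjugate_comp (τ : F →+* ℂ) (h : F ≃ₐ[ℚ] F) :
    conjugate (τ.comp (h : F →+* F)) = (conjugate τ).comp (h : F →+* F) := by
  ext x; simp [conjugate_coe_eq]

/-- **Existence**: for `F/ℚ` Galois and any base embedding `σ₀` there is an automorphism `c` with `σ₀ ∘ c = σ̄₀` (transitivity of
`Aut(F)` on `Hom(F, ℂ)`). [folklore] -/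
theorem exists_conjAut [IsGalois ℚ F] (σ₀ : F →+* ℂ) : ∃ c : F ≃ₐ[ℚ] F, σ₀.comp (c : F →+* F) = conjugate σ₀ := by
  obtain ⟨c, hc⟩ := exists_aut_eq σ₀ (conjugate σ₀)
  exact ⟨c, hc.symm⟩

/-- **Uniqueness**: the automorphism inducing complex conjugation at `σ₀` is unique. [folklore] -/
theorem conjAut_unique (σ₀ : F →+* ℂ) {c c' : F ≃ₐ[ℚ] F} (hc : σ₀.comp (c : F →+* F) = conjugate σ₀)
    (hc' : σ₀.comp (c' : F →+* F) = conjugate σ₀) : c = c' :=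
  comp_aut_injective σ₀ (hc.trans hc'.symm)

/-- It is an involution: `c * c = 1`. [folklore] -/
theorem conjAut_mul_self (σ₀ : F →+* ℂ) {c : F ≃ₐ[ℚ] F} (hc : σ₀.comp (c : F →+* F) = conjugate σ₀) : c * c = 1 := by
  apply comp_aut_injective σ₀
  show σ₀.comp ((c * c : F ≃ₐ[ℚ] F) : F →+* F) = σ₀.comp ((1 : F ≃ₐ[ℚ] F) : F →+* F)
  rw [comp_coe_mul, hc, ← conjugate_comp, hc]
  ext x; simp

/-- … and `≠ 1` as soon as `F` is totally complex (no real embedding is its own conjugate). [folklore] -/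
theorem conjAut_ne_one [IsTotallyComplex F] (σ₀ : F →+* ℂ) {c : F ≃ₐ[ℚ] F}
    (hc : σ₀.comp (c : F →+* F) = conjugate σ₀) : c ≠ 1 := by
  rintro rfl
  have h1 : conjugate σ₀ = σ₀ := by rw [← hc]; ext x; simp
  exact IsTotallyComplex.complexEmbedding_not_isReal σ₀ (ComplexEmbedding.isReal_iff.mpr h1)

/-- Hence it has order `2`. [folklore] -/
theorem orderOf_conjAut [IsTotallyComplex F] (σ₀ : F →+* ℂ) {c : F ≃ₐ[ℚ] F}
    (hc : σ₀.comp (c : F →+* F) = conjugate σ₀) : orderOf c = 2 :=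
  orderOf_eq_prime (by rw [pow_two]; exact conjAut_mul_self σ₀ hc) (conjAut_ne_one σ₀ hc)

/-- **For a CM field it is THE complex conjugation**: `c x = IsCMField.complexConj F x` (every complex embedding of a CM field
intertwines `complexConj` with complex conjugation, Mathlib `IsCMField.complexEmbedding_complexConj`).
[cite: Shimura1998, §8.1 (p. 62) and §6.2 Theorem 3] -/
theorem conjAut_apply [IsCMField F] (σ₀ : F →+* ℂ) {c : F ≃ₐ[ℚ] F} (hc : σ₀.comp (c : F →+* F) = conjugate σ₀)
    (x : F) : c x = IsCMField.complexConj F x := by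
  apply σ₀.injective
  have h1 := RingHom.congr_fun hc x
  simp only [RingHom.coe_comp, RingHom.coe_coe, Function.comp_apply, conjugate_coe_eq] at h1
  rw [h1, IsCMField.complexEmbedding_complexConj]

/-- … so it induces complex conjugation at EVERY embedding (independence of the base embedding). [folklore] -/
theorem comp_conjAut [IsCMField F] (σ₀ : F →+* ℂ) {c : F ≃ₐ[ℚ] F} (hc : σ₀.comp (c : F →+* F) = conjugate σ₀)
    (τ : F →+* ℂ) : τ.comp (c : F →+* F) = conjugate τ := by
  ext x
  simp only [RingHom.coe_comp, RingHom.coe_coe, Function.comp_apply, conjugate_coe_eq]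
  rw [conjAut_apply σ₀ hc, IsCMField.complexEmbedding_complexConj]

/-- **Places through the dictionary**: `σ₀ ∘ x` and `σ₀ ∘ y` lie over the same infinite place iff `y = x` or `y = c x`. [folklore] -/
theorem mk_comp_eq_mk_comp_iff (σ₀ : F →+* ℂ) {c : F ≃ₐ[ℚ] F} (hc : σ₀.comp (c : F →+* F) = conjugate σ₀)
    (x y : F ≃ₐ[ℚ] F) :
    InfinitePlace.mk (σ₀.comp (x : F →+* F)) = InfinitePlace.mk (σ₀.comp (y : F →+* F)) ↔ x = y ∨ c * x = y := by
  rw [InfinitePlace.mk_eq_iff, conjugate_comp, ← hc, ← comp_coe_mul]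
  exact or_congr (comp_aut_injective σ₀).eq_iff (comp_aut_injective σ₀).eq_iff

/-- … and it is CENTRAL in `Aut(F)`. [folklore] -/
theorem conjAut_comm [IsCMField F] (σ₀ : F →+* ℂ) {c : F ≃ₐ[ℚ] F} (hc : σ₀.comp (c : F →+* F) = conjugate σ₀)
    (g : F ≃ₐ[ℚ] F) : g * c = c * g := by
  ext x
  rw [AlgEquiv.mul_apply, AlgEquiv.mul_apply, conjAut_apply σ₀ hc, conjAut_apply σ₀ hc]
  apply σ₀.injective
  have h2 := IsCMField.complexEmbedding_complexConj F (σ₀.comp (g : F →+* F)) x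
  simp only [RingHom.coe_comp, RingHom.coe_coe, Function.comp_apply] at h2
  rw [h2, IsCMField.complexEmbedding_complexConj F σ₀ (g x)]

end ConjAut

/-! ## §2 Enumerations from a group dictionary -/

section GroupEnum

variable {n : ℕ} (Γ : CMGaloisType n) {A : Type*} [Mul A] {G : Type*} [Fintype G]

/-- **An enumeration from a group dictionary.**  `enum : Fin n → G` injective onto a finite type of cardinality `n` and multiplicative
for `Γ` w.r.t. a binary operation `op` (seat b30's `table_spec`), `φ : A → G` a bijection multiplicative for `op`: then `ε := enum⁻¹ ∘ φ`
is a bijection `A ≃ Fin n`, multiplicative for `Γ`, reading `φ` through `enum`. [folklore] -/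
theorem exists_enum_of_groupEnum (op : G → G → G) (enum : Fin n → G)
    (henum : ∀ i j, enum (Γ.mul i j) = op (enum i) (enum j)) (hinj : Function.Injective enum)
    (hcard : Fintype.card G = n) (φ : A → G) (hφ : Function.Bijective φ) (hφmul : ∀ g h, φ (g * h) = op (φ g) (φ h)) :
    ∃ ε : A ≃ Fin n, (∀ g h, ε (g * h) = Γ.mul (ε g) (ε h)) ∧ ∀ g, enum (ε g) = φ g := by
  classical
  have hbij : Function.Bijective enum := by
    rw [Fintype.bijective_iff_injective_and_card]
    exact ⟨hinj, by rw [Fintype.card_fin, hcard]⟩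
  have key : ∀ g, enum (((Equiv.ofBijective φ hφ).trans (Equiv.ofBijective enum hbij).symm) g) = φ g := fun g =>
    Equiv.ofBijective_apply_symm_apply enum hbij (φ g)
  refine ⟨(Equiv.ofBijective φ hφ).trans (Equiv.ofBijective enum hbij).symm, fun g h => hinj ?_, key⟩
  rw [henum, key, key, key, hφmul]

/-- A map into an additive group that is multiplicative-to-additive and injective carries an involution `c ≠ 1` to a non-zero
element killed by `2`. [folklore] -/
theorem involution_of_map_add {A : Type*} [Group A] {G : Type*} [AddGroup G] (φ : A → G) (hφ : Function.Injective φ)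
    (hφmul : ∀ g h, φ (g * h) = φ g + φ h) {c : A} (hcc : c * c = 1) (hc1 : c ≠ 1) :
    φ c ≠ 0 ∧ φ c + φ c = 0 := by
  have h1 : φ 1 = 0 := by
    have h := hφmul 1 1
    rw [mul_one] at h
    exact (left_eq_add.mp h)
  refine ⟨fun h0 => hc1 (hφ (h0.trans h1.symm)), ?_⟩
  rw [← hφmul, hcc, h1]

end GroupEnum

/-! ## §3 Cyclic groups: the dictionary from ONE generator -/

section Cyclic

variable {n : ℕ} [NeZero n] (Γ : CMGaloisType n) {A : Type*} [Group A]

/-- **Cyclic dictionary.**  `A` a group generated by `g` with `Nat.card A = n`, `enum : Fin n → ZMod n` seat b30's additive dictionary of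
a cyclic census table (`table_spec`).  Then there is an enumeration `ε : A ≃ Fin n`, multiplicative for `Γ`, under which `g ^ k` READS
`k (mod n)`, and every involution `c ≠ 1` of `A` reads a non-zero element of `ZMod n` killed by `2` (Mathlib `zmodMulEquivOfGenerator`).
[folklore] -/
theorem exists_enum_of_generator (enum : Fin n → ZMod n) (henum : ∀ i j, enum (Γ.mul i j) = enum i + enum j)
    (hinj : Function.Injective enum) {g : A} (hg : ∀ x, x ∈ Subgroup.zpowers g) (hn : Nat.card A = n) :
    ∃ ε : A ≃ Fin n, (∀ x y, ε (x * y) = Γ.mul (ε x) (ε y)) ∧ (∀ k : ℕ, enum (ε (g ^ k)) = (k : ZMod n)) ∧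
      ∀ c : A, c * c = 1 → c ≠ 1 → enum (ε c) ≠ 0 ∧ enum (ε c) + enum (ε c) = 0 := by
  have hφ : Function.Bijective (fun x : A => Multiplicative.toAdd ((zmodMulEquivOfGenerator hg hn).symm x)) :=
    Multiplicative.toAdd.bijective.comp (zmodMulEquivOfGenerator hg hn).symm.bijective
  obtain ⟨ε, hε, hread⟩ := exists_enum_of_groupEnum Γ (· + ·) enum henum hinj (ZMod.card n)
    (fun x : A => Multiplicative.toAdd ((zmodMulEquivOfGenerator hg hn).symm x)) hφ
    (fun x y => by simp only [map_mul, toAdd_mul])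
  refine ⟨ε, hε, fun k => ?_, fun c hcc hc1 => involution_of_map_add (fun x => enum (ε x)) (hinj.comp ε.injective)
    (fun x y => by simp only [hε, henum]) hcc hc1⟩
  rw [hread]
  show Multiplicative.toAdd ((zmodMulEquivOfGenerator hg hn).symm (g ^ k)) = (k : ZMod n)
  rw [← zpow_natCast, zmodMulEquivOfGenerator_symm_apply_zpow, toAdd_ofAdd, Int.cast_natCast]

omit [NeZero n] in
/-- Under an enumeration reading `g ^ k` as `k (mod n)`, the index of `g ^ k` for `k < n` IS `k` — as soon as `enum` is the standard
dictionary `i ↦ (i : ZMod n)` of the cyclic census files. [folklore] -/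
theorem enum_pow_eq (ε : A ≃ Fin n) {g : A} (hread : ∀ k : ℕ, ((ε (g ^ k)).val : ZMod n) = (k : ZMod n)) (k : Fin n) :
    ε (g ^ (k : ℕ)) = k := by
  have h := hread k
  have h1 : ((ε (g ^ (k : ℕ))).val : ZMod n) = ((k : ℕ) : ZMod n) := h
  exact Fin.ext (by
    have := congrArg ZMod.val h1
    rwa [ZMod.val_natCast, ZMod.val_natCast, Nat.mod_eq_of_lt (ε (g ^ (k : ℕ))).isLt, Nat.mod_eq_of_lt k.isLt] at this)

/-- Every element of a group generated by `g` with `Nat.card A = n` is `g ^ k` for some `k < n`. [folklore] -/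
theorem exists_pow_eq_of_generator {g : A} (hg : ∀ x, x ∈ Subgroup.zpowers g) (hn : Nat.card A = n) (x : A) :
    ∃ k : Fin n, g ^ (k : ℕ) = x := by
  obtain ⟨m, rfl⟩ := (zmodMulEquivOfGenerator hg hn).surjective x
  refine ⟨⟨(Multiplicative.toAdd m).val, ZMod.val_lt _⟩, ?_⟩
  conv_rhs => rw [← ofAdd_toAdd m, ← ZMod.natCast_zmod_val (Multiplicative.toAdd m), ← Int.cast_natCast,
    zmodMulEquivOfGenerator_apply_ofAdd_intCast, zpow_natCast]

end Cyclic

/-! ## §4 Where complex conjugation goes: involutions of the census groups (all by `decide`) -/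

section Involutions

/-- `ZMod 8`: the only non-zero element killed by `2` is `4`. [folklore] -/
theorem zmod_eight_involution : ∀ x : ZMod 8, x ≠ 0 → x + x = 0 → x = 4 := by decide

/-- `ZMod 10`: the only non-zero element killed by `2` is `5`. [folklore] -/
theorem zmod_ten_involution : ∀ x : ZMod 10, x ≠ 0 → x + x = 0 → x = 5 := by decide

/-- `ZMod 12`: the only non-zero element killed by `2` is `6`. [folklore] -/
theorem zmod_twelve_involution : ∀ x : ZMod 12, x ≠ 0 → x + x = 0 → x = 6 := by decide

/-- `DihedralGroup 4`: the only CENTRAL involution is `r 2`. [folklore] -/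
theorem dihedralGroup_four_central_involution :
    ∀ x : DihedralGroup 4, x ≠ 1 → x * x = 1 → (∀ y, x * y = y * x) → x = DihedralGroup.r 2 := by decide

/-- `QuaternionGroup 2` (`Q₈`): the only involution is `a 2`. [folklore] -/
theorem quaternionGroup_two_involution : ∀ x : QuaternionGroup 2, x ≠ 1 → x * x = 1 → x = QuaternionGroup.a 2 := by decide

/-- `ZMod 4 × ZMod 2`: the involutions are `(2,0)`, `(0,1)`, `(2,1)`. [folklore] -/
theorem zmod_four_two_involution :
    ∀ x : ZMod 4 × ZMod 2, x ≠ 0 → x + x = 0 → x = (2, 0) ∨ x = (0, 1) ∨ x = (2, 1) := by decide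

/-- `ZMod 4 × ZMod 2`: the only non-zero DOUBLE is `(2,0)` (so a square involution reads `(2,0)`). [folklore] -/
theorem zmod_four_two_double : ∀ y : ZMod 4 × ZMod 2, y + y ≠ 0 → y + y = (2, 0) := by decide

/-- `ZMod 4 × ZMod 2`: the two non-square involutions are exchanged with `(0,1)` by an additive bijection fixing nothing else of
relevance (`(a,b) ↦ (a + 2b, b)` or the identity). [folklore] -/
theorem zmod_four_two_normalise (v : ZMod 4 × ZMod 2) (hv : v = (0, 1) ∨ v = (2, 1)) :
    ∃ ψ : ZMod 4 × ZMod 2 → ZMod 4 × ZMod 2, Function.Bijective ψ ∧ (∀ x y, ψ (x + y) = ψ x + ψ y) ∧ ψ v = (0, 1) := by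
  rcases hv with rfl | rfl
  · exact ⟨fun x => x, Function.bijective_id, fun _ _ => rfl, rfl⟩
  · exact ⟨fun x => (x.1 + 2 * x.2.cast, x.2), by decide, by decide, by decide⟩

/-- `ZMod 2 × ZMod 2 × ZMod 2`: every non-zero vector is carried to `(1,0,0)` by an additive bijection (transitivity of `GL₃(𝔽₂)` on
non-zero vectors, by seven explicit matrices). [folklore] -/
theorem zmod_two_cube_normalise (v : ZMod 2 × ZMod 2 × ZMod 2) (hv : v ≠ 0) :
    ∃ ψ : ZMod 2 × ZMod 2 × ZMod 2 → ZMod 2 × ZMod 2 × ZMod 2,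
      Function.Bijective ψ ∧ (∀ x y, ψ (x + y) = ψ x + ψ y) ∧ ψ v = (1, 0, 0) := by
  obtain ⟨a, b, c⟩ := v
  fin_cases a <;> fin_cases b <;> fin_cases c
  all_goals first
    | exact absurd rfl hv
    | exact ⟨fun x => x, Function.bijective_id, fun _ _ => rfl, by decide⟩
    | exact ⟨fun x => (x.2.1, x.1, x.2.2), by decide, by decide, by decide⟩
    | exact ⟨fun x => (x.2.2, x.2.1, x.1), by decide, by decide, by decide⟩
    | exact ⟨fun x => (x.1, x.1 + x.2.1, x.2.2), by decide, by decide, by decide⟩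
    | exact ⟨fun x => (x.1, x.2.1, x.1 + x.2.2), by decide, by decide, by decide⟩
    | exact ⟨fun x => (x.2.1, x.2.1 + x.2.2, x.1), by decide, by decide, by decide⟩
    | exact ⟨fun x => (x.1, x.1 + x.2.1, x.1 + x.2.2), by decide, by decide, by decide⟩

end Involutions

end Summit.HodgeConjecture.CorCM.FaceCensus

end
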